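/-
Copyright (c) 2026. All rights reserved.
Released under Apache 2.0 license as described in the file LICENSE.
Authors: abc-iut cell, seat abc-iut-w5-d053 (gen 4; row «COR37-LOGOBS-GLUE», part (b) of abc-iut-L4-t5's
«COR37-COMPAT-LITERAL» split — the family laws of the glued homotopies).
-/
import Literature.AnabelianGeometry.AbsoluteAnabelian.AbsTopIII.BiAnabelianLogGlueCross
import Literature.AnabelianGeometry.AbsoluteAnabelian.AbsTopIII.BiAnabelianLogGlueSaturated
import HarnessLib

/-!
# [AbsTopIII] Cor 3.7 (iii), second clause — the glued homotopies on `𝒟*` satisfy the laws of a family of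
# homotopies (Def 3.5 (ii)): identity, composition, whiskering

S. Mochizuki, *Topics in absolute anabelian geometry III* [MochizukiAbsTopIII2015] (kurims manuscript
`paper:url-5493eb38cbb7`), Cor 3.7 (iii) p. 88 (the family of `𝔖†_log` "is compatible with the families of
homotopies that constitute the core and telecore structures of (i), (ii)"), Def 3.5 (ii) p. 75 (the laws of a
family of homotopies `ζ`: `ζ_{(γ,γ)} = id`, `ζ_{ϖ''} = ζ_{ϖ'} ∘ ζ_ϖ`, whiskering).

Continuation of `BiAnabelianLogGlueEta.lean` / `…Cross.lean` (`glueLogη`: the homotopy of a glued pair; the cross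
identities as natural transformations).
PROOF-ONLY.  The three laws required by abc-iut-L4-t12's `HomotopyFamily.mkOfStrict`:
* `glueLogη_refl`, `glueLogη_trans` — on pairs into `𝔈` they are the laws of abc-iut-L4-t5's `K₀ = coresFamily`;
  elsewhere presentations compose (`exists_glueDec_comp`: the dichotomy of cells, the unique split at the last visit
  to `ref`, and the calculus of `eqToHom`s);
* `glueLogη_whisker` — pre-whiskering moves a cell behind a prefix (through `ref` or not: `exists_glueDec_of_cell`);
  post-whiskering out of `𝒩` is trivial or the edge `𝒩 → 𝔈`, and THERE the law is the CROSS IDENTITY between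
  `K₀` and the cell homotopies: abc-iut-L4-t5's `coresFamily_η_timesGal_app` (p448024, hypothesis (H×): `ι_×` lies
  over the canonical identification of Galois groups) and `coresFamily_η_logGal_app` (p453334, hypothesis (Hlog) for
  `ι_log`), as natural transformations (`coresFamily_η_cellGal_heq`, `…Cross.lean`), together with
  `coresFamily_η_eq_eqToHom_of_eq_comp` (p446533/p446969) for the re-routed prefixes.
The family itself and the closer `logObsCompatCoresStmt_of_iotaOverGal` follow in `BiAnabelianLogGlueFamily.lean`.

HONEST FRAMING: bookkeeping over the cell's typing of refereed pre-IUT material; (H×)/(Hlog) are displayed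
hypotheses (TRUE at the model: abc-iut-L4-t5's `modelSetting_iotaTimes_overGal` / `modelSetting_iotaLog_overGal`,
p447746), no `Prop` fact; nothing here bears on [IUTchIII] Cor. 3.12.
-/

set_option autoImplicit false

namespace Literature.AnabelianGeometry.AbsoluteAnabelian.AbsTopIII

open CategoryTheory Quiver
open Literature.AnabelianGeometry.AbsoluteAnabelian.DiagramOfCategories

universe u

namespace BiAnabelianSetting

open StarGlue

variable {X E N : Type u} [Category.{u} X] [Category.{u} E] [Category.{u} N]
  (𝔖 : BiAnabelianSetting X E N)

/-- An `eqToHom`-sandwich is heterogeneously its core (abc-iut-L4-t5's lemma, short name).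
[cite: MochizukiAbsTopIII2015, Definition 3.5 (ii) p.75] -/
private theorem sw₁ {A : Type*} [Category A] {a a' b b' : A} (ha : a = a') (hb : b' = b) (f : a' ⟶ b') :
    HEq (eqToHom ha ≫ f ≫ eqToHom hb) f :=
  HomotopyFamily.heq_eqToHom_comp_comp_eqToHom ha hb f

/-! ### Presentations compose; every cell pair is presented -/

/-- **Presentations compose** (Def 3.5 (ii) composition law at the level of presentations): for presentations of
`(P, Q)` and `(Q, R)` there is one of `(P, R)` carrying the composite homotopy — two cells compose only when one
is reflexive (`StarCell.dichotomy`), ref-free tails after the last visit are unique (`split_unique`), the cell class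
and the tail classes do not meet. [cite: MochizukiAbsTopIII2015, Cor 3.7 (iii) p.88] -/
theorem exists_glueDec_comp {a b : Cor37Vertex} {P Q R : StarPath.{u} a b} (d₁ : GlueDec P Q) (d₂ : GlueDec Q R) :
    ∃ d₃ : GlueDec P R, d₃.val 𝔖 = d₁.val 𝔖 ≫ d₂.val 𝔖 := by
  cases d₁ with
  | rfl h =>
    subst h
    exact ⟨d₂, by rw [val_rfl, eqToHom_refl, Category.id_comp]⟩
  | reroute p q t ht hP hQ =>
    cases d₂ with
    | rfl h' =>
      subst h'
      exact ⟨GlueDec.reroute p q t ht hP hQ, by rw [val_rfl, eqToHom_refl, Category.comp_id]⟩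
    | reroute p' q' t' ht' hP' hQ' =>
      obtain ⟨e₁, e₂⟩ := split_unique q p' t t' (hQ.symm.trans hP') ht ht'
      subst e₁ e₂
      exact ⟨GlueDec.reroute p q' t ht hP hQ', by rw [val_reroute, val_reroute, val_reroute, eqToHom_trans]⟩
    | cell g hg hP' hQ' =>
      have : VisitsRef g.left := by rw [← hP', hQ]; exact visitsRef_comp_ref q t
      exact absurd this hg
    | tailCell p' q' g hg hP' hQ' =>
      obtain ⟨e₁, e₂⟩ := split_unique q p' t g.left (hQ.symm.trans hP') ht hg
      subst e₁ e₂
      refine ⟨GlueDec.tailCell p q' g hg hP hQ', ?_⟩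
      rw [val_tailCell, val_reroute, val_tailCell]
      apply eq_of_heq
      refine ((sw₁ _ _ _).trans (𝔖.tailVal_heq p q' g)).trans ?_
      exact ((eqToHom_comp_heq _ _).trans ((sw₁ _ _ _).trans (𝔖.tailVal_heq q q' g))).symm
  | cell g hg hP hQ =>
    cases d₂ with
    | rfl h' =>
      subst h'
      exact ⟨GlueDec.cell g hg hP hQ, by rw [val_rfl, eqToHom_refl, Category.comp_id]⟩
    | reroute p' q' t' ht' hP' hQ' =>
      have : VisitsRef g.right := by rw [← hQ, hP']; exact visitsRef_comp_ref p' t'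
      exact absurd ((StarCell.visitsRef_left_iff g).2 this) hg
    | cell g' hg' hP' hQ' =>
      have e : g.right = g'.left := hQ.symm.trans hP'
      rcases StarCell.dichotomy e with el | er
      · refine ⟨GlueDec.cell g' hg' (hP.trans (el.trans e)) hQ', ?_⟩
        rw [val_cell, val_cell, val_cell, 𝔖.cellη_of_eq g el (by rw [el])]
        apply eq_of_heq
        refine (sw₁ _ _ _).trans ?_
        rw [eqToHom_trans, eqToHom_trans]
        exact ((eqToHom_comp_heq _ _).trans (sw₁ _ _ _)).symm
      · refine ⟨GlueDec.cell g hg hP (hQ'.trans (er.trans e.symm)), ?_⟩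
        rw [val_cell, val_cell, val_cell, 𝔖.cellη_of_eq g' er.symm (by rw [er])]
        apply eq_of_heq
        refine (sw₁ _ _ _).trans ?_
        rw [eqToHom_trans, eqToHom_trans]
        exact ((comp_eqToHom_heq _ _).trans (sw₁ _ _ _)).symm
    | tailCell p' q' g' hg' hP' hQ' =>
      have : VisitsRef g.right := by rw [← hQ, hP']; exact visitsRef_comp_ref p' g'.left
      exact absurd ((StarCell.visitsRef_left_iff g).2 this) hg
  | tailCell p q g hg hP hQ =>
    have hgr : refCount g.right = 0 := by rw [← StarCell.refCount_left_eq_right]; exact hg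
    cases d₂ with
    | rfl h' =>
      subst h'
      exact ⟨GlueDec.tailCell p q g hg hP hQ, by rw [val_rfl, eqToHom_refl, Category.comp_id]⟩
    | reroute p' q' t' ht' hP' hQ' =>
      obtain ⟨e₁, e₂⟩ := split_unique q p' g.right t' (hQ.symm.trans hP') hgr ht'
      subst e₁ e₂
      refine ⟨GlueDec.tailCell p q' g hg hP hQ', ?_⟩
      rw [val_tailCell, val_tailCell, val_reroute]
      apply eq_of_heq
      refine ((sw₁ _ _ _).trans (𝔖.tailVal_heq p q' g)).trans ?_
      refine (whiskerLeft_heq (𝔖.pathFunctor'_eq_of_target_ref q' q) rfl rfl HEq.rfl).trans ?_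
      exact ((comp_eqToHom_heq _ _).trans ((sw₁ _ _ _).trans (𝔖.tailVal_heq p q g))).symm
    | cell g' hg' hP' hQ' =>
      have : VisitsRef g'.left := by rw [← hP', hQ]; exact visitsRef_comp_ref q g.right
      exact absurd this hg'
    | tailCell p' q' g' hg' hP' hQ' =>
      obtain ⟨e₁, e⟩ := split_unique q p' g.right g'.left (hQ.symm.trans hP') hgr hg'
      subst e₁
      rcases StarCell.dichotomy e with el | er
      · refine ⟨GlueDec.tailCell p q' g' hg' (by rw [hP, el, e]) hQ', ?_⟩
        rw [𝔖.val_tailCell_eq_eqToHom p q g hg hP hQ el (by rw [hP, hQ, 𝔖.pathFunctor'_reroute p q, el]),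
          val_tailCell, val_tailCell]
        apply eq_of_heq
        refine ((sw₁ _ _ _).trans (𝔖.tailVal_heq p q' g')).trans ?_
        exact ((eqToHom_comp_heq _ _).trans ((sw₁ _ _ _).trans (𝔖.tailVal_heq q q' g'))).symm
      · refine ⟨GlueDec.tailCell p q' g hg hP (by rw [hQ', er, ← e]), ?_⟩
        rw [𝔖.val_tailCell_eq_eqToHom q q' g' hg' hP' hQ' er.symm
            (by rw [hP', hQ', 𝔖.pathFunctor'_reroute q q', er]),
          val_tailCell, val_tailCell]
        apply eq_of_heq
        refine ((sw₁ _ _ _).trans (𝔖.tailVal_heq p q' g)).trans ?_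
        refine (whiskerLeft_heq (𝔖.pathFunctor'_eq_of_target_ref q' q) rfl rfl HEq.rfl).trans ?_
        exact ((comp_eqToHom_heq _ _).trans ((sw₁ _ _ _).trans (𝔖.tailVal_heq p q g))).symm

/-- **Every cell pair is presented, with the cell homotopy** (whether or not its sides visit `ref`: a cell through
`ref` is a ref-free cell behind a prefix, `StarCell.exists_precomp_of_visitsRef`).
[cite: MochizukiAbsTopIII2015, Cor 3.7 (iii) p.88] -/
theorem exists_glueDec_of_cell {c : Cor37Vertex} (g : StarCell.{u} c) {P Q : StarPath.{u} c Cor37Vertex.space}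
    (hP : P = g.left) (hQ : Q = g.right) : ∃ d : GlueDec P Q, HEq (d.val 𝔖) (𝔖.cellη g) := by
  by_cases hv : VisitsRef g.left
  · obtain ⟨s, g₀, rfl, hg₀⟩ := StarCell.exists_precomp_of_visitsRef g hv
    exact ⟨GlueDec.tailCell s s g₀ hg₀ (hP.trans (StarCell.left_precomp s g₀))
        (hQ.trans (StarCell.right_precomp s g₀)),
      (𝔖.val_tailCell_heq s s g₀ hg₀ _ _).trans (𝔖.cellη_precomp_heq s g₀).symm⟩
  · exact ⟨GlueDec.cell g hv hP hQ, 𝔖.val_cell_heq g hv hP hQ⟩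

/-! ### The three laws -/

/-- **Identity law** (Def 3.5 (ii): `ζ_{([γ],[γ])}` is the identity). [cite: MochizukiAbsTopIII2015, Cor 3.7 (iii) p.88] -/
theorem glueLogη_refl {a b : Cor37Vertex} {P : StarPath.{u} a b} (h : GlueE P P) : 𝔖.glueLogη h = 𝟙 _ := by
  by_cases hb : b = Cor37Vertex.galois
  · subst hb
    rw [𝔖.glueLogη_of_galois h ((𝔖.coresFamily_E_iff P P).2 rfl), 𝔖.coresFamily.η_refl, Category.id_comp,
      eqToHom_trans, eqToHom_refl]
  · rw [𝔖.glueLogη_eq_val h hb (GlueDec.rfl rfl), val_rfl, eqToHom_refl]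

/-- **Composition law** (Def 3.5 (ii): `ζ_{ϖ''} = ζ_{ϖ'} ∘ ζ_ϖ`). [cite: MochizukiAbsTopIII2015, Cor 3.7 (iii) p.88] -/
theorem glueLogη_trans {a b : Cor37Vertex} {P Q R : StarPath.{u} a b} (h₁ : GlueE P Q) (h₂ : GlueE Q R) :
    𝔖.glueLogη (isSaturated_glueE.trans h₁ h₂) = 𝔖.glueLogη h₁ ≫ 𝔖.glueLogη h₂ := by
  by_cases hb : b = Cor37Vertex.galois
  · subst hb
    have hK₁ : 𝔖.coresFamily.E P Q := (𝔖.coresFamily_E_iff P Q).2 rfl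
    have hK₂ : 𝔖.coresFamily.E Q R := (𝔖.coresFamily_E_iff Q R).2 rfl
    have ht : 𝔖.coresFamily.η ((𝔖.coresFamily_E_iff P R).2 rfl) = 𝔖.coresFamily.η hK₁ ≫ 𝔖.coresFamily.η hK₂ :=
      𝔖.coresFamily.η_trans hK₁ hK₂
    rw [𝔖.glueLogη_of_galois h₁ hK₁, 𝔖.glueLogη_of_galois h₂ hK₂, 𝔖.glueLogη_of_galois _ ((𝔖.coresFamily_E_iff P R).2 rfl),
      ht]
    simp only [Category.assoc, eqToHom_trans_assoc, eqToHom_refl, Category.id_comp]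
  · obtain ⟨d₁⟩ := nonempty_glueDec h₁ hb
    obtain ⟨d₂⟩ := nonempty_glueDec h₂ hb
    obtain ⟨d₃, hd₃⟩ := 𝔖.exists_glueDec_comp d₁ d₂
    rw [𝔖.glueLogη_eq_val h₁ hb d₁, 𝔖.glueLogη_eq_val h₂ hb d₂, 𝔖.glueLogη_eq_val _ hb d₃, hd₃]

/-- **Whiskering law** (Def 3.5 (ii): `ζ_{([γ₃]∘[γ₁]∘[γ₄], [γ₃]∘[γ₂]∘[γ₄])} = 𝒟_[γ₃] ∘ ζ ∘ 𝒟_[γ₄]`), under (H×), (Hlog).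
Into `𝔈` from `𝔈`: `K₀`'s law.  Into `𝔈` from elsewhere: the post-whisker is `𝒩 → 𝔈` and the law is the cross
identity (`coresFamily_η_cellGal_heq`), after re-routing the prefixes (`coresFamily_η_eq_eqToHom_of_eq_comp`).  Off
`𝔈`: the post-whisker is trivial and pre-whiskering moves cells behind prefixes (`exists_glueDec_of_cell`).
[cite: MochizukiAbsTopIII2015, Cor 3.7 (iii) p.88] -/
theorem glueLogη_whisker
    (hT : ∀ y : X, 𝔖.spaceGal.map (𝔖.iotaTimes.app y) = 𝔖.lamTimesGal.hom.app y ≫ 𝔖.lamTimesPfGal.inv.app y)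
    (hL : ∀ A : X, 𝔖.spaceGal.map (𝔖.iotaLog.app A) =
      𝔖.lamTimesGal.hom.app (𝔖.log.obj A) ≫ 𝔖.logGal.hom.app A ≫ 𝔖.lamTimesPfGal.inv.app A)
    {a b c d : Cor37Vertex} {P Q : StarPath.{u} a b} (h : GlueE P Q) (r₁ : StarPath.{u} c a)
    (r₂ : StarPath.{u} b d) :
    𝔖.glueLogη (isSaturated_glueE.precomp (isSaturated_glueE.postcomp h r₂) r₁) =
      eqToHom (by rw [pathFunctor'_comp, pathFunctor'_comp]) ≫
        Functor.whiskerLeft (𝔖.starDiagram.pathFunctor' r₁)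
          (Functor.whiskerRight (𝔖.glueLogη h) (𝔖.starDiagram.pathFunctor' r₂)) ≫
        eqToHom (by rw [pathFunctor'_comp, pathFunctor'_comp]) := by
  refine (conj_eqToHom_iff_heq' _ _ _ _).2 ?_
  by_cases hd : d = Cor37Vertex.galois
  · subst hd
    by_cases hb : b = Cor37Vertex.galois
    · -- into `𝔈` from `𝔈`: `K₀`'s whiskering law
      subst hb
      obtain rfl := path_galois_galois_eq r₂
      have hK : 𝔖.coresFamily.E P Q := (𝔖.coresFamily_E_iff P Q).2 rfl
      refine (𝔖.glueLogη_heq_of_galois _ ((𝔖.coresFamily_E_iff _ _).2 rfl)).trans ?_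
      refine (heq_of_eq (𝔖.coresFamily.η_whisker hK r₁ Path.nil)).trans ?_
      refine (sw₁ _ _ _).trans ?_
      exact whiskerLeft_heq (pathFunctor_eq_pathFunctor' _ r₁)
        (by rw [pathFunctor_eq_pathFunctor', pathFunctor_eq_pathFunctor'])
        (by rw [pathFunctor_eq_pathFunctor', pathFunctor_eq_pathFunctor'])
        (whiskerRight_heq (pathFunctor_eq_pathFunctor' _ P) (pathFunctor_eq_pathFunctor' _ Q)
          (𝔖.glueLogη_heq_of_galois h hK).symm (pathFunctor_eq_pathFunctor' _ _))
    · -- into `𝔈` from elsewhere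
      obtain ⟨d₀⟩ := nonempty_glueDec h hb
      rw [𝔖.glueLogη_eq_val h hb d₀]
      refine (𝔖.glueLogη_heq_of_galois _ ((𝔖.coresFamily_E_iff _ _).2 rfl)).trans ?_
      cases d₀ with
      | rfl e =>
        subst e
        rw [val_rfl, eqToHom_whiskerRight, whiskerLeft_eqToHom, 𝔖.coresFamily.η_refl]
        exact (eqToHom_heq_id _ (by rw [pathFunctor_eq_pathFunctor', pathFunctor'_comp, pathFunctor'_comp])).symm
      | reroute p q t ht hP hQ =>
        subst hP hQ
        have e₁ : r₁.comp ((p.comp t).comp r₂) = (r₁.comp p).comp (t.comp r₂) := by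
          simp only [Path.comp_assoc]
        have e₂ : r₁.comp ((q.comp t).comp r₂) = (r₁.comp q).comp (t.comp r₂) := by
          simp only [Path.comp_assoc]
        rw [val_reroute, eqToHom_whiskerRight, whiskerLeft_eqToHom,
          𝔖.coresFamily_η_eq_eqToHom_of_eq_comp (r₁.comp p) (r₁.comp q) (t.comp r₂) e₁ e₂ _
            (by rw [e₁, e₂]; exact 𝔖.pathFunctor_comp_eq_of_through_ref _ _ _)]
        exact eqToHom_heq_eqToHom _ _
          (by rw [pathFunctor_eq_pathFunctor', pathFunctor'_comp, pathFunctor'_comp])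
      | cell g hg hP hQ =>
        subst hP hQ
        obtain rfl := path_space_galois_eq r₂
        have e₁ : r₁.comp (g.left.comp ((Path.nil : StarPath.{u} _ _).cons Cor37Edge.toGal)) =
            (g.precomp r₁).left.cons Cor37Edge.toGal := by
          rw [StarCell.left_precomp]; rfl
        have e₂ : r₁.comp (g.right.comp ((Path.nil : StarPath.{u} _ _).cons Cor37Edge.toGal)) =
            (g.precomp r₁).right.cons Cor37Edge.toGal := by
          rw [StarCell.right_precomp]; rfl
        refine (𝔖.coresFamily_η_heq_congr e₁ e₂ _ ((𝔖.coresFamily_E_iff _ _).2 rfl)).trans ?_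
        refine (𝔖.coresFamily_η_cellGal_heq hT hL (g.precomp r₁) _).trans ?_
        refine (whiskerRight_heq (by rw [StarCell.left_precomp, pathFunctor'_comp])
          (by rw [StarCell.right_precomp, pathFunctor'_comp]) (𝔖.cellη_precomp_heq r₁ g) rfl).trans ?_
        rw [whiskerRight_whiskerLeft, val_cell]
        exact whiskerLeft_heq rfl rfl rfl (whiskerRight_heq rfl rfl (sw₁ _ _ _).symm rfl)
      | tailCell p q g hg hP hQ =>
        subst hP hQ
        obtain rfl := path_space_galois_eq r₂
        have m₁ : 𝔖.coresFamily.E (r₁.comp ((p.comp g.left).comp ((Path.nil : StarPath.{u} _ _).cons Cor37Edge.toGal)))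
            (r₁.comp ((q.comp g.left).comp ((Path.nil : StarPath.{u} _ _).cons Cor37Edge.toGal))) :=
          (𝔖.coresFamily_E_iff _ _).2 rfl
        have m₂ : 𝔖.coresFamily.E (r₁.comp ((q.comp g.left).comp ((Path.nil : StarPath.{u} _ _).cons Cor37Edge.toGal)))
            (r₁.comp ((q.comp g.right).comp ((Path.nil : StarPath.{u} _ _).cons Cor37Edge.toGal))) :=
          (𝔖.coresFamily_E_iff _ _).2 rfl
        have ht : 𝔖.coresFamily.η ((𝔖.coresFamily_E_iff _ _).2 rfl) = 𝔖.coresFamily.η m₁ ≫ 𝔖.coresFamily.η m₂ :=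
          𝔖.coresFamily.η_trans m₁ m₂
        have e₁ : r₁.comp ((p.comp g.left).comp ((Path.nil : StarPath.{u} _ _).cons Cor37Edge.toGal)) =
            (r₁.comp p).comp (g.left.comp ((Path.nil : StarPath.{u} _ _).cons Cor37Edge.toGal)) := by
          simp only [Path.comp_assoc]
        have e₂ : r₁.comp ((q.comp g.left).comp ((Path.nil : StarPath.{u} _ _).cons Cor37Edge.toGal)) =
            (r₁.comp q).comp (g.left.comp ((Path.nil : StarPath.{u} _ _).cons Cor37Edge.toGal)) := by
          simp only [Path.comp_assoc]
        rw [ht, 𝔖.coresFamily_η_eq_eqToHom_of_eq_comp (r₁.comp p) (r₁.comp q) _ e₁ e₂ m₁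
          (by rw [e₁, e₂]; exact 𝔖.pathFunctor_comp_eq_of_through_ref _ _ _)]
        refine (eqToHom_comp_heq _ _).trans ?_
        have e₃ : r₁.comp ((q.comp g.left).comp ((Path.nil : StarPath.{u} _ _).cons Cor37Edge.toGal)) =
            (g.precomp (r₁.comp q)).left.cons Cor37Edge.toGal := by
          simp only [StarCell.left_precomp, Path.comp_cons, Path.comp_nil, Path.comp_assoc]
        have e₄ : r₁.comp ((q.comp g.right).comp ((Path.nil : StarPath.{u} _ _).cons Cor37Edge.toGal)) =
            (g.precomp (r₁.comp q)).right.cons Cor37Edge.toGal := by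
          simp only [StarCell.right_precomp, Path.comp_cons, Path.comp_nil, Path.comp_assoc]
        refine (𝔖.coresFamily_η_heq_congr e₃ e₄ m₂ ((𝔖.coresFamily_E_iff _ _).2 rfl)).trans ?_
        refine (𝔖.coresFamily_η_cellGal_heq hT hL (g.precomp (r₁.comp q)) _).trans ?_
        refine (whiskerRight_heq (by rw [StarCell.left_precomp, pathFunctor'_comp])
          (by rw [StarCell.right_precomp, pathFunctor'_comp]) (𝔖.cellη_precomp_heq (r₁.comp q) g) rfl).trans ?_
        rw [whiskerRight_whiskerLeft, val_tailCell]
        refine (whiskerLeft_heq (pathFunctor'_comp _ r₁ q) rfl rfl HEq.rfl).trans ?_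
        rw [← whiskerLeft_whiskerLeft, ← whiskerRight_whiskerLeft]
        exact whiskerLeft_heq rfl (by rw [𝔖.pathFunctor'_reroute p q, pathFunctor'_comp]; rfl)
          (by rw [pathFunctor'_comp]; rfl)
          (whiskerRight_heq (by rw [𝔖.pathFunctor'_reroute p q, pathFunctor'_comp]) (by rw [pathFunctor'_comp])
            ((sw₁ _ _ _).trans (𝔖.tailVal_heq p q g)).symm rfl)
  · -- off `𝔈`: trivial post-whisker
    have hb : b ≠ Cor37Vertex.galois := by
      rintro rfl
      exact hd (eq_galois_of_path_galois r₂)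
    obtain ⟨d₀⟩ := nonempty_glueDec h hb
    rw [𝔖.glueLogη_eq_val h hb d₀]
    cases d₀ with
    | rfl e =>
      subst e
      rw [𝔖.glueLogη_eq_val _ hd (GlueDec.rfl rfl), val_rfl, val_rfl, eqToHom_whiskerRight, whiskerLeft_eqToHom]
      exact eqToHom_heq_eqToHom _ _ (by rw [pathFunctor'_comp, pathFunctor'_comp])
    | reroute p q t ht hP hQ =>
      subst hP hQ
      obtain ⟨p', q', t', ht', e₁, e₂⟩ := exists_glueDec_reroute (r₁.comp p) (r₁.comp q) (t.comp r₂)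
      rw [𝔖.glueLogη_eq_val _ hd (GlueDec.reroute p' q' t' ht'
          (by rw [← e₁]; simp only [Path.comp_assoc]) (by rw [← e₂]; simp only [Path.comp_assoc])),
        val_reroute, val_reroute, eqToHom_whiskerRight, whiskerLeft_eqToHom]
      exact eqToHom_heq_eqToHom _ _ (by rw [pathFunctor'_comp, pathFunctor'_comp])
    | cell g hg hP hQ =>
      subst hP hQ
      cases r₂ with
      | cons t e =>
        exact absurd (eq_galois_of_path_cons (d := Cor37Vertex.space) (by simp [Cor37Vertex.row]) t e) hd
      | nil =>
        obtain ⟨dL, hdL⟩ := 𝔖.exists_glueDec_of_cell (g.precomp r₁)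
          (P := r₁.comp (g.left.comp Path.nil)) (Q := r₁.comp (g.right.comp Path.nil))
          (by rw [StarCell.left_precomp]; rfl) (by rw [StarCell.right_precomp]; rfl)
        rw [𝔖.glueLogη_eq_val _ hd dL, val_cell]
        refine hdL.trans ((𝔖.cellη_precomp_heq r₁ g).trans ?_)
        exact whiskerLeft_heq rfl rfl rfl ((whiskerRight_id_heq _).trans (sw₁ _ _ _)).symm
    | tailCell p q g hg hP hQ =>
      subst hP hQ
      cases r₂ with
      | cons t e =>
        exact absurd (eq_galois_of_path_cons (d := Cor37Vertex.space) (by simp [Cor37Vertex.row]) t e) hd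
      | nil =>
        rw [𝔖.glueLogη_eq_val _ hd (GlueDec.tailCell (P := r₁.comp ((p.comp g.left).comp Path.nil))
            (Q := r₁.comp ((q.comp g.right).comp Path.nil)) (r₁.comp p) (r₁.comp q) g hg
            (by simp only [Path.comp_nil, Path.comp_assoc]) (by simp only [Path.comp_nil, Path.comp_assoc])),
          val_tailCell, val_tailCell]
        refine ((sw₁ _ _ _).trans (𝔖.tailVal_heq _ _ g)).trans ?_
        refine (whiskerLeft_heq (pathFunctor'_comp _ r₁ q) rfl rfl HEq.rfl).trans ?_
        rw [← whiskerLeft_whiskerLeft]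
        exact whiskerLeft_heq rfl (by rw [𝔖.pathFunctor'_reroute p q, pathFunctor'_comp]; rfl)
          (by rw [pathFunctor'_comp]; rfl)
          (((whiskerRight_id_heq _).trans ((sw₁ _ _ _).trans (𝔖.tailVal_heq p q g))).symm)

end BiAnabelianSetting

end Literature.AnabelianGeometry.AbsoluteAnabelian.AbsTopIII
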